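import Mathlib
import Summits.CriticalPhenomena.CardyFormulaZ2.Theorems.CardySelfRefinementDefs
import Summits.CriticalPhenomena.CardyFormulaZ2.Theorems.CardySelfRefinementTrivialSectorRateStubBoundaryRelevanceTwoArmWindowAlong
import Literature.Probability.Percolation.InwardDocking
import HarnessLib

/-!
# The lowest vertex of a far-reaching cluster: the universal exponent `2` for `M_k` along an RSW
# path (line `far-field-is-a-quarter-turn`, crux `TrivialSectorRate`, stmt-CriticalPhenomena-10266)

Helper file of the stub `stub_boundaryRelevance` (HB): the (HB) input at BOUNDED inner scale (the
contact layer of `weightedRelevanceMass_of_factorisation`) and the anchor of every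
quasi-multiplicativity statement for three half-plane arms is the universal bound
`M_k(γ s)(lowestFar x R) ≤ C / R²`, uniformly in `s` and `x`, where `lowestFar x R` says: `x` is
joined by an open lattice path to sup-distance `> R`, and every site joined to `x` by an open
lattice path inside `x + B(R)` is `x` or lies STRICTLY ABOVE `x` (the point form of the wired
half-plane three-arm event; the closed arms are the two sides of the lower frontier of the cluster).
Proof (the classical "lowest point" count, run for the dependent model `M_k`): such sites of `B(N)`
lie in DISTINCT crossing clusters of the open graph of `B(M)` (`card_filter_mem_lowestOfCrossing_le`),
so their probabilities summed over `S ⊆ B(N)` are `≤ E[Z] ≤ 1` for a law with the tail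
`ν(Z ≥ i) ≤ 2^{-i}` (`sum_real_lowestOfCrossing_le_one`); `lowestFar x R ⊆ lowestOfCrossing M x`
for `x ∈ B(N)`, `M + N ≤ R` (`lowestFar_subset_lowestOfCrossing`); `lowestFar` is translation
covariant (`preimage_relabel_shift_lowestFar`) and `M_k` is `kℤ²`-invariant, so the `(2n+1)²`
sites `x + k a`, `a ∈ B(n)`, are equiprobable; with `N = k(n+1)`, `M = K₀N` (RSW ratio,
`exists_ratio_real_preimage_boxCrossingEvent_le_half_along`; tail,
`M_real_setOf_le_numCrossingClusters_shift_induce_le_pow`): `M_k(lowestFar x R) ≤ 4(K₀+1)²k²/R²`.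
-/
noncomputable section

namespace Summit.CriticalPhenomena.CardyFormulaZ2.Theorems.CardySelfRefinement.FarField

open Set MeasureTheory SimpleGraph
open Literature.Probability.LatticeModels Literature.Probability.Percolation
open Literature.Probability.Percolation.QuadCrossing
open Summit.CriticalPhenomena.CardyFormulaZ2.Theses.CardySelfRefinement

/-! ### The strict lowest vertex of a crossing cluster: counting -/

/-- `x` is the **strict lowest vertex of a crossing cluster** of the open graph of `B(M)`: `x` is
joined in `boxOpenGraph ω M` to a site of the sphere `‖·‖_∞ = M`, and every site joined to `x` is
`x` itself or lies strictly above `x`. -/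
def lowestOfCrossing (M : ℕ) (x : Site 2) : Set (BondConfig (Site 2)) :=
  {ω | (∃ y ∈ siteSphere M, (boxOpenGraph ω M).Reachable x y) ∧
    ∀ y, (boxOpenGraph ω M).Reachable x y → y = x ∨ x 1 < y 1}

/-- Two strict lowest vertices of the same cluster coincide. -/
theorem eq_of_mem_lowestOfCrossing {ω : BondConfig (Site 2)} {M : ℕ} {x x' : Site 2}
    (hx : ω ∈ lowestOfCrossing M x) (hx' : ω ∈ lowestOfCrossing M x')
    (h : (boxOpenGraph ω M).Reachable x x') : x = x' := by
  rcases hx.2 x' h with h1 | h1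
  · exact h1.symm
  rcases hx'.2 x h.symm with h2 | h2
  · exact h2
  · exact absurd (h1.trans h2) (lt_irrefl _)

open Classical in
/-- **Counting.**  The sites of `S ⊆ B(N)` that are strict lowest vertices of crossing clusters of
the open graph of `B(M)` lie in pairwise distinct crossing clusters (`eq_of_mem_lowestOfCrossing`),
so there are at most `Z = numCrossingClusters ω N M` of them. -/
theorem card_filter_mem_lowestOfCrossing_le (ω : BondConfig (Site 2)) {N M : ℕ} {S : Finset (Site 2)}
    (hS : S ⊆ box 2 N) :
    (S.filter fun x => ω ∈ lowestOfCrossing M x).card ≤ numCrossingClusters ω N M := by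
  set W := S.filter fun x => ω ∈ lowestOfCrossing M x with hW
  have hmem : ∀ x : W, IsCrossingCluster ω N M ((boxOpenGraph ω M).connectedComponentMk x.1) := by
    intro x
    have hx := Finset.mem_filter.1 x.2
    obtain ⟨y, hy, hr⟩ := hx.2.1
    exact ⟨⟨x.1, hS hx.1, rfl⟩, y, hy, (ConnectedComponent.sound hr).symm⟩
  set f : W → {C // IsCrossingCluster ω N M C} := fun x => ⟨_, hmem x⟩ with hf
  have hinj : Function.Injective f := by
    intro x x' h
    have h' : (boxOpenGraph ω M).connectedComponentMk x.1 =
        (boxOpenGraph ω M).connectedComponentMk x'.1 := congrArg Subtype.val h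
    exact Subtype.ext (eq_of_mem_lowestOfCrossing (Finset.mem_filter.1 x.2).2
      (Finset.mem_filter.1 x'.2).2 (ConnectedComponent.exact h'))
  have h := Nat.card_le_card_of_injective f hinj
  unfold numCrossingClusters
  rwa [Nat.card_eq_fintype_card (α := W), Fintype.card_coe] at h

/-- The event "`x` is the strict lowest vertex of a crossing cluster of `B(M)`" is determined by
the edges of `B(M)`. -/
theorem determinedBy_lowestOfCrossing (M : ℕ) (x : Site 2) :
    DeterminedBy (lowestOfCrossing M x) ↑(boxEdges M) := by
  rw [determinedBy_iff]
  intro ω ω' h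
  simp only [lowestOfCrossing, Set.mem_setOf_eq]
  rw [← boxOpenGraph_inter_boxEdges ω, ← boxOpenGraph_inter_boxEdges ω', h]

/-- Hence it is measurable. -/
theorem measurableSet_lowestOfCrossing (M : ℕ) (x : Site 2) :
    MeasurableSet (lowestOfCrossing M x) :=
  measurableSet_of_isLocalEvent_holds ⟨_, determinedBy_lowestOfCrossing M x⟩

/-- **Sum over sites.**  For a probability law with the tail `ν(Z ≥ i) ≤ 2^{-i}` of the number of
crossing clusters of `B(M) ∖ B(N)`, the probabilities that the sites of `S ⊆ B(N)` are strict lowest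
vertices of crossing clusters sum to at most `E[Z] ≤ 1`. -/
theorem sum_real_lowestOfCrossing_le_one (ν : Measure (BondConfig (Site 2)))
    [IsProbabilityMeasure ν] {N M : ℕ}
    (htail : ∀ i : ℕ, ν.real {ω | i ≤ numCrossingClusters ω N M} ≤ (1 / 2) ^ i)
    {S : Finset (Site 2)} (hS : S ⊆ box 2 N) :
    ∑ x ∈ S, ν.real (lowestOfCrossing M x) ≤ 1 := by
  classical
  have hZ : ∫ ω, (numCrossingClusters ω N M : ℝ) ∂ν ≤ 1 := by
    have h := integral_numCrossingClusters_inter_le_one ν Set.univ N M (by simpa using htail)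
    simpa using h
  have hpt : ∀ ω, ∑ x ∈ S, (lowestOfCrossing M x).indicator
      (fun _ => (1 : ℝ)) ω ≤ (numCrossingClusters ω N M : ℝ) := by
    intro ω
    have hsum : ∑ x ∈ S, (lowestOfCrossing M x).indicator
        (fun _ => (1 : ℝ)) ω = ((S.filter fun x => ω ∈ lowestOfCrossing M x).card : ℝ) := by
      rw [Finset.card_filter, Nat.cast_sum]
      refine Finset.sum_congr rfl fun x _ => ?_
      by_cases h : ω ∈ lowestOfCrossing M x
      · rw [Set.indicator_of_mem h, if_pos h, Nat.cast_one]
      · rw [Set.indicator_of_notMem h, if_neg h, Nat.cast_zero]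
    rw [hsum]
    exact_mod_cast card_filter_mem_lowestOfCrossing_le ω hS
  have hint : ∀ x ∈ S, Integrable (fun ω => (lowestOfCrossing M x).indicator (fun _ => (1 : ℝ)) ω) ν :=
    fun x _ => (integrable_const _).indicator (measurableSet_lowestOfCrossing M x)
  have hZint : Integrable (fun ω => (numCrossingClusters ω N M : ℝ)) ν := by
    refine Integrable.of_bound (C := ((box 2 N).card : ℝ)) ?_ (ae_of_all _ fun ω => ?_)
    · have hZm : Measurable fun ω : BondConfig (Site 2) => numCrossingClusters ω N M :=
        measurable_to_countable' fun i =>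
          measurableSet_of_isLocalEvent_holds (isLocalEvent_setOf_numCrossingClusters N M (· = i))
      exact ((measurable_from_nat (f := (Nat.cast : ℕ → ℝ))).comp hZm).aestronglyMeasurable
    · rw [Real.norm_eq_abs, abs_of_nonneg (Nat.cast_nonneg _)]
      exact_mod_cast numCrossingClusters_le_card ω N M
  calc ∑ x ∈ S, ν.real (lowestOfCrossing M x)
      = ∑ x ∈ S, ∫ ω, (lowestOfCrossing M x).indicator
          (fun _ => (1 : ℝ)) ω ∂ν := by
        refine Finset.sum_congr rfl fun x _ => ?_
        rw [integral_indicator_const _ (measurableSet_lowestOfCrossing M x), smul_eq_mul,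
          mul_one]
    _ = ∫ ω, ∑ x ∈ S, (lowestOfCrossing M x).indicator
          (fun _ => (1 : ℝ)) ω ∂ν := (integral_finsetSum _ hint).symm
    _ ≤ ∫ ω, (numCrossingClusters ω N M : ℝ) ∂ν :=
        integral_mono (integrable_finsetSum _ hint) hZint hpt
    _ ≤ 1 := hZ

/-! ### The translation-covariant event and its comparison with the count -/

/-- **The lowest-far event at `x`, radius `R`** (translation covariant): an open lattice path
from `x` to a site at sup-distance `> R` from `x`, and every site joined to `x` by an open lattice
path inside `x + B(R)` is `x` or lies strictly above `x`. -/
def lowestFar (x : Site 2) (R : ℕ) : Set (BondConfig (Site 2)) :=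
  {ω | (∃ (w : Site 2) (P : (zdGraph 2).Walk x w), w - x ∉ box 2 R ∧ ∀ e ∈ P.edges, e ∈ ω) ∧
    ∀ (y : Site 2) (P : (zdGraph 2).Walk x y), (∀ z ∈ P.support, z - x ∈ box 2 R) →
      (∀ e ∈ P.edges, e ∈ ω) → y = x ∨ x 1 < y 1}

/-- A walk of the open graph of `B(M)` (for a lattice configuration) is an open lattice walk inside
`B(M)`. -/
theorem exists_zdWalk_of_boxWalk {ω : BondConfig (Site 2)} (hω : ω ⊆ (zdGraph 2).edgeSet) {M : ℕ} :
    ∀ {u y : Site 2} (_ : (boxOpenGraph ω M).Walk u y), u ∈ box 2 M →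
      ∃ P : (zdGraph 2).Walk u y, (∀ e ∈ P.edges, e ∈ ω) ∧ ∀ z ∈ P.support, z ∈ box 2 M := by
  intro u y w
  induction w with
  | nil =>
    intro hub
    refine ⟨Walk.nil, by simp, fun z hz => ?_⟩
    rw [Walk.support_nil, List.mem_singleton] at hz
    exact hz ▸ hub
  | @cons u' v' w' hadj w ih =>
    intro _
    obtain ⟨huv, -, hvb, -⟩ := boxOpenGraph_adj.1 hadj
    obtain ⟨P, hPω, hP⟩ := ih hvb
    have hadj' : (zdGraph 2).Adj u' v' := (mem_edgeSet (G := zdGraph 2)).1 (hω huv)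
    refine ⟨Walk.cons hadj' P, fun e he => ?_, fun z hz => ?_⟩
    · rw [Walk.edges_cons, List.mem_cons] at he
      rcases he with rfl | he
      exacts [huv, hPω e he]
    · rw [Walk.support_cons, List.mem_cons] at hz
      rcases hz with rfl | hz
      exacts [by assumption, hP z hz]

/-- Differences of sites of `B(M)` and `B(N)` lie in `B(M + N)`. -/
theorem sub_mem_box_add {M N : ℕ} {z x : Site 2} (hz : z ∈ box 2 M) (hx : x ∈ box 2 N) :
    z - x ∈ box 2 (M + N) := by
  rw [mem_box] at hz hx ⊢
  intro i
  have h1 := hz i; have h2 := hx i; simp only [Pi.sub_apply, Nat.cast_add]; omega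

/-- **Comparison.**  For a lattice configuration, `x ∈ B(N)`, `1 ≤ M`, `N ≤ M` and `M + N ≤ R`: if
`lowestFar x R` holds then `x` is the strict lowest vertex of a crossing cluster of `B(M) ∖ B(N)`
(stop the far arm at its first exit from `B(M)`; a walk of the open graph of `B(M)` stays in
`x + B(M + N) ⊆ x + B(R)`). -/
theorem lowestFar_subset_lowestOfCrossing {ω : BondConfig (Site 2)} (hω : ω ⊆ (zdGraph 2).edgeSet)
    {N M R : ℕ} (hM : 1 ≤ M) (hNM : N ≤ M) (hR : M + N ≤ R) {x : Site 2} (hx : x ∈ box 2 N)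
    (h : ω ∈ lowestFar x R) : ω ∈ lowestOfCrossing M x := by
  obtain ⟨⟨w, P, hw, hP⟩, hlow⟩ := h
  have hxM : x ∈ (↑(box 2 M) : Set (Site 2)) := Finset.mem_coe.2 (box_mono 2 hNM hx)
  have hwM : w ∉ (↑(box 2 M) : Set (Site 2)) := by
    intro hw'
    exact hw (box_mono 2 hR (sub_mem_box_add (Finset.mem_coe.1 hw') hx))
  constructor
  · obtain ⟨x', z, q₁, hxz, hz, hA, -, hedges, -⟩ := exists_prefix_exit P hxM hwM
    have hx'box : x' ∈ box 2 M := Finset.mem_coe.1 (hA x' q₁.end_mem_support)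
    have hx'S : x' ∈ siteSphere M :=
      Z2HalfPlane.mem_siteSphere_of_adj_not_mem hM hx'box hxz (fun h => hz (Finset.mem_coe.2 h))
    have hE : ∀ e ∈ q₁.edges, e ∈ (boxOpenGraph ω M).edgeSet := by
      intro e he
      induction e using Sym2.ind with
      | _ a b =>
        have hadj : (zdGraph 2).Adj a b := (mem_edgeSet (G := zdGraph 2)).1 (q₁.edges_subset_edgeSet he)
        rw [mem_edgeSet, boxOpenGraph_adj]
        exact ⟨hP _ (hedges _ he), Finset.mem_coe.1 (hA _ (q₁.fst_mem_support_of_mem_edges he)),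
          Finset.mem_coe.1 (hA _ (q₁.snd_mem_support_of_mem_edges he)), hadj.ne⟩
    exact ⟨x', hx'S, ⟨q₁.transfer _ hE⟩⟩
  · rintro y ⟨q⟩
    obtain ⟨Q, hQω, hQ⟩ := exists_zdWalk_of_boxWalk hω q (box_mono 2 hNM hx)
    exact hlow y Q (fun z hz => box_mono 2 hR (sub_mem_box_add (hQ z hz) hx)) hQω

/-! ### Translation covariance -/

/-- Translating the configuration by `v` carries `lowestFar x R` to `lowestFar (x + v) R`. -/
theorem relabel_shift_mem_lowestFar {x : Site 2} {R : ℕ} {ω : BondConfig (Site 2)} (v : Site 2)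
    (h : ω ∈ lowestFar x R) :
    BondConfig.relabel (sym2Equiv (Site.shift v)) ω ∈ lowestFar (x + v) R := by
  obtain ⟨⟨w, P, hw, hP⟩, hlow⟩ := h
  refine ⟨⟨w + v, (P.map (zdShiftIso v).toHom).copy (zdShiftIso_apply v x) (zdShiftIso_apply v w),
    ?_, ?_⟩, ?_⟩
  · rwa [add_sub_add_right_eq_sub]
  · intro e he
    rw [Walk.edges_copy] at he
    exact forall_edges_map_shift_mem_relabel P hP e he
  · intro y Q hQs hQe
    -- translate the walk back by `-v`
    set Q' : (zdGraph 2).Walk x (y + -v) :=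
      (Q.map (zdShiftIso (-v)).toHom).copy ((zdShiftIso_apply (-v) (x + v)).trans
        (add_neg_cancel_right x v)) (zdShiftIso_apply (-v) y) with hQ'
    have hQ'e : ∀ e ∈ Q'.edges, e ∈ ω := by
      intro e he
      rw [hQ', Walk.edges_copy] at he
      have := forall_edges_map_shift_mem_relabel (v := -v) Q hQe e he
      rwa [Literature.Probability.Percolation.relabel_shift_neg_relabel_shift] at this
    have hQ's : ∀ z ∈ Q'.support, z - x ∈ box 2 R := by
      intro z hz
      rw [hQ', Walk.support_copy, Walk.support_map, List.mem_map] at hz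
      obtain ⟨z₀, hz₀, rfl⟩ := hz
      have e : (zdShiftIso (-v)).toHom z₀ - x = z₀ - (x + v) := by
        show z₀ + -v - x = z₀ - (x + v); abel
      exact e ▸ hQs z₀ hz₀
    rcases hlow (y + -v) Q' hQ's hQ'e with h1 | h1
    · exact Or.inl (by rw [← h1]; abel)
    · have e1 : (y + -v) 1 = y 1 - v 1 := by simp [sub_eq_add_neg]
      have e2 : (x + v) 1 = x 1 + v 1 := by simp
      rw [e1] at h1
      exact Or.inr (by rw [e2]; linarith)

/-- **Translation covariance**: `{ω | ω + v ∈ lowestFar (x + v) R} = lowestFar x R`. -/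
theorem preimage_relabel_shift_lowestFar (x v : Site 2) (R : ℕ) :
    BondConfig.relabel (sym2Equiv (Site.shift v)) ⁻¹' lowestFar (x + v) R = lowestFar x R := by
  ext ω
  refine ⟨fun h => ?_, fun h => relabel_shift_mem_lowestFar v h⟩
  have := relabel_shift_mem_lowestFar (-v) h
  rwa [Literature.Probability.Percolation.relabel_shift_neg_relabel_shift,
    add_neg_cancel_right] at this

/-- `M_k`-probabilities of `lowestFar` are `kℤ²`-periodic in the site. -/
theorem M_real_lowestFar_add_smul {k : ℕ} (hk : k ≠ 0) (ρ c₀ : ℝ) (x a : Site 2) (R : ℕ) :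
    (M k ρ c₀).real (lowestFar (x + (k : ℤ) • a) R) = (M k ρ c₀).real (lowestFar x R) := by
  rw [← preimage_relabel_shift_lowestFar x ((k : ℤ) • a) R]
  exact (M_real_preimage_relabel_shift_smul hk ρ c₀ a _).symm

/-! ### The exponent-2 bound along the path -/

/-- **THE LOWEST VERTEX OF A FAR-REACHING CLUSTER: EXPONENT `2` FOR `M_k` ALONG AN RSW PATH**
(helper of the stub `stub_boundaryRelevance`; the universal half-plane three-arm bound at unit
inner scale for the dependent model `M_k`, uniformly in the path parameter).  For `PathOK k γ`,
`k = 2, 3`, there are `C > 0` and `R₀` such that for every `s`, every site `x` and every `R ≥ R₀`,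
`M_k(γ s)(lowestFar x R) ≤ C / R²`.  Proof: reduce `x` modulo `kℤ²` (periodicity); the
`(2n+1)²` translates `x + k a`, `a ∈ B(n)`, `N = k(n+1)`, all have the same probability, each is
at most the probability that the site is the strict lowest vertex of a crossing cluster of
`B(K₀N) ∖ B(N)`, and these sum to `≤ E[Z] ≤ 1` by the counting and the BK/RSW tail of `Z`. -/
theorem lowestFar_decay_along {k : ℕ} (hk : k = 2 ∨ k = 3) {γ : unitInterval → ℝ × ℝ}
    (hγ : PathOK k γ) :
    ∃ C : ℝ, 0 < C ∧ ∃ R₀ : ℕ, ∀ (s : unitInterval) (x : Site 2) (R : ℕ), R₀ ≤ R →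
      (M k (γ s).1 (γ s).2).real (lowestFar x R) ≤ C / (R : ℝ) ^ 2 := by
  have hk0 : 0 < k := by rcases hk with rfl | rfl <;> norm_num
  have hk3 : k ≤ 3 := by rcases hk with rfl | rfl <;> norm_num
  obtain ⟨K₀, N₀, hK₀, hN₀, hA⟩ := exists_ratio_real_preimage_boxCrossingEvent_le_half_along hk hγ
  -- the block `L = (K₀ + 1) k` and the threshold `R₀ = L (N₀ + 2)`
  obtain ⟨L, hL⟩ : ∃ L : ℕ, L = (K₀ + 1) * k := ⟨_, rfl⟩
  have hL1 : 1 ≤ L := hL ▸ Nat.one_le_iff_ne_zero.2 (Nat.mul_ne_zero (by omega) hk0.ne')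
  refine ⟨4 * (L : ℝ) ^ 2, by positivity, L * (N₀ + 2), fun s x R hR => ?_⟩
  -- reduce the site modulo `kℤ²`
  obtain ⟨x₁, a₀, hx₁, rfl⟩ : ∃ (x₁ a₀ : Site 2), x₁ ∈ box 2 k ∧ x = x₁ + (k : ℤ) • a₀ := by
    refine ⟨fun i => x i % (k : ℤ), fun i => x i / (k : ℤ), ?_, ?_⟩
    · rw [mem_box]
      intro i
      have hkz : (0 : ℤ) < k := by exact_mod_cast hk0
      have h1 := Int.emod_nonneg (x i) hkz.ne'
      have h2 := Int.emod_lt_of_pos (x i) hkz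
      constructor <;> omega
    · funext i
      simp only [Pi.add_apply, Pi.smul_apply, smul_eq_mul]
      exact (Int.emod_add_mul_ediv (x i) k).symm
  have hred : (M k (γ s).1 (γ s).2).real (lowestFar (x₁ + (k : ℤ) • a₀) R) =
      (M k (γ s).1 (γ s).2).real (lowestFar x₁ R) := M_real_lowestFar_add_smul hk0.ne' _ _ x₁ a₀ R
  rw [hred]
  set μ := M k (γ s).1 (γ s).2 with hμ
  haveI : IsProbabilityMeasure μ := isProbabilityMeasure_M k (γ s).1 (γ s).2
  -- scales: `n + 1 = R / L ≥ N₀ + 2`, `N = k (n + 1)`, `M = K₀ N`, `M + N ≤ R`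
  have hdiv : N₀ + 2 ≤ R / L :=
    (Nat.le_div_iff_mul_le (by omega)).2 (by rw [mul_comm]; exact hR)
  obtain ⟨n, hn⟩ : ∃ n : ℕ, n + 1 = R / L := ⟨R / L - 1, by omega⟩
  have hnN₀ : N₀ + 2 ≤ n + 1 := hn ▸ hdiv
  obtain ⟨N, hN⟩ : ∃ N : ℕ, N = k * (n + 1) := ⟨_, rfl⟩
  obtain ⟨Mr, hMr⟩ : ∃ Mr : ℕ, Mr = K₀ * N := ⟨_, rfl⟩
  have hNN₀ : N₀ ≤ N := by
    rw [hN]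
    calc N₀ ≤ n + 1 := by omega
      _ ≤ k * (n + 1) := Nat.le_mul_of_pos_left _ hk0
  have hNM : N ≤ Mr := by rw [hMr]; exact Nat.le_mul_of_pos_left N (by omega)
  have hM1 : 1 ≤ Mr := (hN₀.trans hNN₀).trans hNM
  have hMNR : Mr + N ≤ R := by
    have h1 : R / L * L ≤ R := Nat.div_mul_le_self R L
    have h2 : Mr + N = (n + 1) * L := by rw [hMr, hN, hL]; ring
    rw [← hn] at h1
    omega
  -- the translates `x₁ + k a`, `a ∈ B(n)`, lie in `B(N)`
  set S : Finset (Site 2) := (box 2 n).image fun a => x₁ + (k : ℤ) • a with hS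
  have hSN : S ⊆ box 2 N := by
    intro y hy
    rw [hS, Finset.mem_image] at hy
    obtain ⟨a, ha, rfl⟩ := hy
    rw [mem_box] at ha hx₁ ⊢
    intro i
    have h1 := ha i; have h2 := hx₁ i
    simp only [Pi.add_apply, Pi.smul_apply, smul_eq_mul, hN, Nat.cast_mul, Nat.cast_add,
      Nat.cast_one]
    have hkz : (0 : ℤ) ≤ k := by positivity
    constructor <;> nlinarith
  have hcard : S.card = (2 * n + 1) ^ 2 := by
    have hkz : (k : ℤ) ≠ 0 := by exact_mod_cast hk0.ne'
    rw [hS, Finset.card_image_of_injective _ fun a b hab =>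
      smul_right_injective (Site 2) hkz (add_left_cancel hab), card_box]
  -- the translated law (by `0`) is carried by lattice configurations and has the tail of `Z`
  set T := BondConfig.relabel (sym2Equiv (Site.shift (0 : Site 2))) with hT
  haveI : IsProbabilityMeasure (μ.map T) :=
    Measure.isProbabilityMeasure_map T.measurable.aemeasurable
  have hae : ∀ᵐ ω ∂(μ.map T), ω ⊆ (zdGraph 2).edgeSet := by
    refine T.measurableEmbedding.ae_map_iff.2 ?_
    filter_upwards [selfRefinementMeasure_ae_subset_edgeSet k (γ s).1 (γ s).2] with ω hω
    exact relabel_shift_subset_edgeSet _ hω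
  have htail : ∀ i : ℕ, (μ.map T).real {ω | i ≤ numCrossingClusters ω N Mr} ≤ (1 / 2) ^ i := by
    intro i
    rw [hT, real_map_relabel_shift, preimage_setOf_eq]
    have h0 := M_real_setOf_le_numCrossingClusters_shift_induce_le_pow hk0 hk3 (γ s) (0 : Site 2)
      Set.univ N Mr i
    simp only [Set.mem_univ, implies_true, Set.setOf_true, Set.inter_univ] at h0
    refine h0.trans (pow_le_pow_left₀ measureReal_nonneg ?_ i)
    rw [hMr]
    exact hA s 0 N hNN₀
  -- sum over the translates
  have hsum := sum_real_lowestOfCrossing_le_one (μ.map T) htail hSN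
  have hterm : ∀ y ∈ S, μ.real (lowestFar x₁ R) ≤ (μ.map T).real (lowestOfCrossing Mr y) := by
    intro y hy
    have hyx : μ.real (lowestFar y R) = μ.real (lowestFar x₁ R) := by
      rw [hS, Finset.mem_image] at hy
      obtain ⟨a, -, rfl⟩ := hy
      exact M_real_lowestFar_add_smul hk0.ne' _ _ x₁ a R
    rw [← hyx]
    have hpre : μ.real (lowestFar y R) = (μ.map T).real (lowestFar y R) := by
      rw [hT, real_map_relabel_shift]
      congr 1
      have h := preimage_relabel_shift_lowestFar y 0 R
      rw [add_zero] at h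
      exact h.symm
    rw [hpre]
    refine ENNReal.toReal_mono (measure_ne_top _ _) (measure_mono_ae ?_)
    filter_upwards [hae] with ω hω hωy
    exact lowestFar_subset_lowestOfCrossing hω hM1 hNM hMNR (hSN hy) hωy
  have hmain : (S.card : ℝ) * μ.real (lowestFar x₁ R) ≤ 1 := by
    calc (S.card : ℝ) * μ.real (lowestFar x₁ R) = ∑ _y ∈ S, μ.real (lowestFar x₁ R) := by
          rw [Finset.sum_const, nsmul_eq_mul]
      _ ≤ ∑ y ∈ S, (μ.map T).real (lowestOfCrossing Mr y) := Finset.sum_le_sum hterm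
      _ ≤ 1 := hsum
  -- arithmetic: `R ≤ (n + 2) L ≤ 2 L (2n + 1)` and `|S| = (2n+1)²`
  have hLpos : (0 : ℝ) < L := by exact_mod_cast hL1
  have hRpos : (0 : ℝ) < R := by
    have : 1 ≤ R := hL1.trans ((Nat.le_mul_of_pos_right _ (by omega)).trans hR)
    exact_mod_cast this
  have hnR : (R : ℝ) ≤ 2 * L * (2 * n + 1) := by
    have h1 : R < R / L * L + L := Nat.lt_div_mul_add (by omega)
    rw [← hn] at h1
    have h2 : (R : ℝ) < (((n + 1) * L + L : ℕ) : ℝ) := by exact_mod_cast h1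
    push_cast at h2
    nlinarith
  have hcardR : (S.card : ℝ) = ((2 * n + 1 : ℕ) : ℝ) ^ 2 := by rw [hcard]; push_cast; ring
  have hSpos : (0 : ℝ) < S.card := by rw [hcardR]; positivity
  calc μ.real (lowestFar x₁ R) ≤ 1 / S.card := by rw [le_div_iff₀ hSpos, mul_comm]; exact hmain
    _ ≤ 4 * (L : ℝ) ^ 2 / (R : ℝ) ^ 2 := by
        rw [hcardR, div_le_div_iff₀ (by positivity) (by positivity), one_mul]
        calc (R : ℝ) ^ 2 ≤ (2 * L * (2 * n + 1)) ^ 2 := pow_le_pow_left₀ hRpos.le hnR 2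
          _ = 4 * (L : ℝ) ^ 2 * ((2 * n + 1 : ℕ) : ℝ) ^ 2 := by push_cast; ring
end Summit.CriticalPhenomena.CardyFormulaZ2.Theorems.CardySelfRefinement.FarField

end
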